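import Summits.BirchSwinnertonDyer.BirchSwinnertonDyer.Theorems.ResidualThetaTransportAtTwoThetaTransportSelmerSubmodule
import Literature.NumberTheory.EllipticCurves.GreenbergSelmerDualDataExistsProofs
import HarnessLib

/-!
# Module-structure plumbing for the RSL_g line: `H¹(H, M)` and its scalar-stable subgroups as `R`-modules through `scalarH1`,
# and the PRIMITIVE Selmer submodule `Sel_∅ = {s | ∀ v ∈ S₀, ∀ σ, conj_σ s unramified at v}` as a `Submodule`

Route `ResidualThetaTransportAtTwo` (RTT), crux RSL_g `ResidualSignedLambdaLowerCMAtTwo` (stmt-BirchSwinnertonDyer-22608; the (R≥)ᵖ crux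
stmt-BirchSwinnertonDyer-26074 is glue above it); memo `Cruxes/ResidualThetaCountLowerPureAtTwo/DUALITY-KIT-g16.md` §2 (the explicit
predicate `Prim` against which stubs S1/S2/S4 are to be stated). Seat `prover-bsd-wall-rtt-p2` g16 (`--supports`, closes nothing).
THEOREMS ONLY (no definition, no named fact, no instance, no `sorry`): the module structures are produced as EXISTENTIAL witnesses with
their defining equation (the convention of w2's `LambdaLowerBoundO.exists_dualPair_of_stable`), generic in `(G, H, M, R)`; BSD is not proved
by any of this; 22608 / 26074 OPEN.

* §1 **`exists_module_subgroupH1_smul_eq_scalarH1`**, **`exists_module_addSubgroup_smul_eq_scalarH1`** — `scalarH1` is a ring action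
  (tree: `scalarH1_one/_mul/_zero/_add`), so `H¹(H, M)` and every `scalarH1`-stable additive subgroup `Sg` carry an `R`-module structure
  with `r • c = scalarH1 r c` (EPW §3.1 «we regard `Sel(ℚ_∞, A_f)` as a `Λ_𝒪`-module»); this is the structure the entry point
  `LambdaLowerBoundO.cmLambdaLower_of_finrank_characterModule` quantifies over.
* §2 **`exists_submodule_primitive`** — for a `scalarH1`-module `Sg ≤ H¹(H, M)` (`H ⊴ Γ_K`) and a set of places `S₀`: the classes of `Sg`
  all of whose conjugates are unramified at every `v ∈ S₀` form an `R`-SUBMODULE `Prim ≤ Sg` (scalars preserve `unramifiedKer`: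
  `scalarH1_mem_unramifiedKer`, and commute with conjugation: `conjH1_comp_scalarH1`), stable under every `conj_τ` when `Sg` is;
  with `Sg = Sel⁺_{S₀}(ℚ_∞, A_g)` this is the primitive Selmer module `Sel⁺_∅ = ker(res_{S₀})` of the N6 / N5 lemmas.

References: [EmertonPollackWeston2006] §3.1; [GreenbergVatsal2000] §2 pp. 16–17, 23; [NeukirchSchmidtWingberg2008] I §5.
-/

set_option autoImplicit false
-- the Theorems namespace of this sub repeats the summit name by design (D-0017 nested layout)
set_option linter.dupNamespace false

noncomputable section

namespace Summit.BirchSwinnertonDyer.BirchSwinnertonDyer.Theorems.ThetaTransport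

open NumberField Field IsDedekindDomain Literature.NumberTheory.EllipticCurves
  Literature.NumberTheory.EllipticCurves.GreenbergSelmer Literature.NumberTheory.EllipticCurves.GreenbergVatsal2000
  Literature.NumberTheory.GaloisRepresentations

universe u

/-! ### §1. `scalarH1` as an `R`-module structure -/

section ModuleStructure

variable {G : Type u} [Group G] [TopologicalSpace G] [IsTopologicalGroup G] (H : Subgroup G)
  (M : Type u) [AddCommGroup M] [DistribMulAction G M] [TopologicalSpace M] [DiscreteTopology M]
  {R : Type*} [Semiring R] [Module R M] [SMulCommClass G R M]

/-- **`H¹(H, M)` is an `R`-module through `scalarH1`** (`scalarH1_one/_mul/_zero/_add`): there is a `Module R (subgroupH1 H M)`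
structure whose scalar multiplication IS `scalarH1`. [cite: EmertonPollackWeston2006, §3.1 (arXiv:math/0404484 p. 17)] -/
theorem exists_module_subgroupH1_smul_eq_scalarH1 :
    ∃ inst : Module R (subgroupH1 H M), ∀ (r : R) (c : subgroupH1 H M), (letI := inst; r • c) = scalarH1 H M r c := by
  let σ : R →+* AddMonoid.End (subgroupH1 H M) :=
    { toFun := fun r ↦ scalarH1 H M r
      map_one' := scalarH1_one H M
      map_mul' := fun r r' ↦ scalarH1_mul H M r r'
      map_zero' := scalarH1_zero H M
      map_add' := fun r r' ↦ scalarH1_add H M r r' }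
  exact ⟨Module.compHom (subgroupH1 H M) σ, fun _ _ ↦ rfl⟩

/-- **A `scalarH1`-stable additive subgroup `Sg ≤ H¹(H, M)` is an `R`-module through `scalarH1`**: a `Module R Sg` structure with
`((r • s : Sg) : H¹) = scalarH1 r s` (the convention of `exists_dualPair_of_stable` and of the entry point
`cmLambdaLower_of_finrank_characterModule`). [cite: EmertonPollackWeston2006, §3.1 (arXiv:math/0404484 p. 17)] -/
theorem exists_module_addSubgroup_smul_eq_scalarH1 (Sg : AddSubgroup (subgroupH1 H M))
    (hscal : ∀ (r : R) (c : subgroupH1 H M), c ∈ Sg → scalarH1 H M r c ∈ Sg) :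
    ∃ inst : Module R Sg, ∀ (r : R) (s : Sg), ((letI := inst; r • s : Sg) : subgroupH1 H M) = scalarH1 H M r s := by
  let σ : R →+* AddMonoid.End Sg :=
    { toFun := fun r ↦ ((scalarH1 H M r).restrict Sg).codRestrict Sg fun s ↦ hscal r _ s.2
      map_one' := by
        refine DFunLike.ext _ _ fun s ↦ Subtype.ext ?_
        exact DFunLike.congr_fun (scalarH1_one H M (R := R)) (s : subgroupH1 H M)
      map_mul' := by
        intro r r'
        refine DFunLike.ext _ _ fun s ↦ Subtype.ext ?_
        exact DFunLike.congr_fun (scalarH1_mul H M r r') (s : subgroupH1 H M)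
      map_zero' := by
        refine DFunLike.ext _ _ fun s ↦ Subtype.ext ?_
        exact DFunLike.congr_fun (scalarH1_zero H M (R := R)) (s : subgroupH1 H M)
      map_add' := by
        intro r r'
        refine DFunLike.ext _ _ fun s ↦ Subtype.ext ?_
        exact DFunLike.congr_fun (scalarH1_add H M r r') (s : subgroupH1 H M) }
  exact ⟨Module.compHom Sg σ, fun _ _ ↦ rfl⟩

end ModuleStructure

/-! ### §2. The primitive Selmer submodule -/

section Primitive

variable {K : Type} [Field K] [NumberField K] (H : Subgroup (absoluteGaloisGroup K)) [H.Normal]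
  (M : Type) [AddCommGroup M] [DistribMulAction (absoluteGaloisGroup K) M] [TopologicalSpace M] [DiscreteTopology M]
  {R : Type*} [Semiring R] [Module R M] [SMulCommClass (absoluteGaloisGroup K) R M]

/-- **The primitive submodule `Prim ≤ Sg`**: for an additive subgroup `Sg ≤ H¹(H, M)` carrying an `R`-module structure with scalars
`scalarH1`, and a set `S₀` of finite places, `{s ∈ Sg | ∀ v ∈ S₀, ∀ σ ∈ Γ_K, conj_σ s ∈ unramifiedKer v}` is an `R`-submodule (scalars
preserve GV's unramified condition, `scalarH1_mem_unramifiedKer`, and commute with conjugation, `conjH1_comp_scalarH1`). With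
`Sg = Sel⁺_{S₀}(ℚ_∞, A_g)` (no condition at `S₀`) this is `Sel⁺_∅`, the kernel of the restriction to the places above `S₀`.
[cite: GreenbergVatsal2000, §2 pp. 16–17, 23] [cite: EmertonPollackWeston2006, §3.1] -/
theorem exists_submodule_primitive (Sg : AddSubgroup (subgroupH1 H M)) [inst : Module R Sg]
    (hsmul : ∀ (r : R) (s : Sg), ((r • s : Sg) : subgroupH1 H M) = scalarH1 H M r s)
    (S₀ : Set (HeightOneSpectrum (𝓞 K))) :
    ∃ Prim : Submodule R Sg, ∀ s : Sg, s ∈ Prim ↔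
      ∀ v ∈ S₀, ∀ σ : absoluteGaloisGroup K, conjH1 H M σ (s : subgroupH1 H M) ∈ unramifiedKer H M v := by
  refine ⟨{ carrier := {s : Sg | ∀ v ∈ S₀, ∀ σ : absoluteGaloisGroup K, conjH1 H M σ (s : subgroupH1 H M) ∈ unramifiedKer H M v}
            add_mem' := fun {a b} ha hb v hv σ ↦ by
              rw [AddSubgroup.coe_add, map_add]
              exact AddSubgroup.add_mem _ (ha v hv σ) (hb v hv σ)
            zero_mem' := fun v hv σ ↦ by
              rw [ZeroMemClass.coe_zero, map_zero]
              exact AddSubgroup.zero_mem _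
            smul_mem' := fun r s hs v hv σ ↦ by
              rw [hsmul, ← AddMonoidHom.comp_apply, conjH1_comp_scalarH1, AddMonoidHom.comp_apply]
              exact scalarH1_mem_unramifiedKer H M v r (hs v hv σ) }, fun s ↦ Iff.rfl⟩

/-- **`Prim` is stable under conjugation** when `Sg` is: `conj_σ (conj_τ s) = conj_{στ} s` (`conjH1_mul_holds`). So `Prim` inherits the
`Λ`-structure `T = conj_γ − 1`. [cite: GreenbergVatsal2000, §2 pp. 16–17] [cite: NeukirchSchmidtWingberg2008, I.§5] -/
theorem conjH1_mem_primitive (Sg : AddSubgroup (subgroupH1 H M))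
    (hconj : ∀ (τ : absoluteGaloisGroup K) (c : subgroupH1 H M), c ∈ Sg → conjH1 H M τ c ∈ Sg)
    (S₀ : Set (HeightOneSpectrum (𝓞 K))) (τ : absoluteGaloisGroup K) (s : Sg)
    (hs : ∀ v ∈ S₀, ∀ σ : absoluteGaloisGroup K, conjH1 H M σ (s : subgroupH1 H M) ∈ unramifiedKer H M v) :
    ∀ v ∈ S₀, ∀ σ : absoluteGaloisGroup K,
      conjH1 H M σ ((⟨conjH1 H M τ s, hconj τ _ s.2⟩ : Sg) : subgroupH1 H M) ∈ unramifiedKer H M v := by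
  intro v hv σ
  have : conjH1 H M σ (conjH1 H M τ (s : subgroupH1 H M)) = conjH1 H M (σ * τ) (s : subgroupH1 H M) := by
    rw [conjH1_mul_holds H M σ τ, AddMonoidHom.comp_apply]
  rw [this]
  exact hs v hv (σ * τ)

/-- Membership in `Prim` is insensitive to conjugating the test: if all conjugates of `s` are unramified at `v ∈ S₀` then so are all
conjugates of `conj_τ s` (restatement of `conjH1_mem_primitive` on elements of `H¹`). [cite: GreenbergVatsal2000, §2 pp. 16–17] -/
theorem forall_conjH1_mem_unramifiedKer_of_forall (S₀ : Set (HeightOneSpectrum (𝓞 K))) (τ : absoluteGaloisGroup K)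
    (c : subgroupH1 H M) (hc : ∀ v ∈ S₀, ∀ σ : absoluteGaloisGroup K, conjH1 H M σ c ∈ unramifiedKer H M v) :
    ∀ v ∈ S₀, ∀ σ : absoluteGaloisGroup K, conjH1 H M σ (conjH1 H M τ c) ∈ unramifiedKer H M v := by
  intro v hv σ
  rw [← AddMonoidHom.comp_apply, ← conjH1_mul_holds H M σ τ]
  exact hc v hv (σ * τ)

end Primitive

end Summit.BirchSwinnertonDyer.BirchSwinnertonDyer.Theorems.ThetaTransport

end
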